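import Literature.AlgebraicGeometry.VanGeemen1994.WeilDiscriminantClass
import Literature.AlgebraicGeometry.Motives.HyperbolicWeilTypeProduct
import Literature.AlgebraicGeometry.Motives.AimedSplitProductProofs
import Literature.AlgebraicGeometry.HodgeTheory.WeilClassesProductsOfFactors
import Literature.AlgebraicGeometry.HodgeTheory.WeilTypeRationalDatum
import Literature.AlgebraicGeometry.Motives.RationalDegreeOneModel
import HarnessLib

/-!
# The discriminant witness of a product `A × B` of Weil-type pairs (`det H` is multiplicative: Markman arXiv:2509.23403 §11.5 Step 2, our formalisation; the frame and `det H ∈ ℚˣ/Nm(Kˣ)` after van Geemen 1994, Lemma 5.2 (2)–(3))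

research route conditional on HC_CM; not a corollary; Q11.4-sentence-2 already refuted in dim ≥ 3.
(Cell `pub-hodge-ring2`, seat `ab-weil-2`; companion of `VanGeemen1994/WeilDiscriminantClass`
(`HasWeilDiscriminantNondeg`: a `K`-frame `x` of rational degree-one classes with Gram data `(a, b)`,
`det(a + b√-d) = q ∈ ℚˣ`) and of `Motives/HyperbolicWeilTypeProduct` /`Motives/PolarizationPairingProduct`
(the block Gram matrix of the product class `pr_A^* h_A + pr_B^* h_B`). Theorems only.)

ATTRIBUTION (cell referee F-ab-42 / F-ab-45, 2026-08-20). The ONLY printed source for the multiplicativity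
of the discriminant class under products is E. Markman, arXiv:2509.23403 (preprint, UNREFEREED), §11.5
Step 2, arXiv v2 PDF p. 21, lines 37–39 (= v1 p. 21, lines 17–19; "p. 19" of earlier versions of this docstring was the
held corpus chunk p0019, not a PDF page): "The discriminant invariant … is multiplicative under cartesian products" — one sentence,
no proof. This file is OUR FORMALISATION OF THAT PUBLISHED STATEMENT on the carriers (admissible under
`Literature/` in exactly this sense); the proof (block Gram matrices in a product frame) is ours. Van Geemen,
LNM 1594 (1994), Lemma 5.2 (2)–(3) is cited ONLY for the definition of the `K`-frame / Gram matrix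
`Ψ = a + b√-d`, for `det Ψ ∈ ℚ^*/Nm(K^*)`, and for "`det Ψ` … is an isogeny invariant of `(X, K, E)`" — it does
NOT state multiplicativity (the earlier title of this file misattributed it; theorem statements unchanged).
Context: C. Schoen, Compositio 114 (1998) §10 (the invariant of `(H₁(A;ℤ) ⊕ V'_ℤ, ψ_A ⊕ ψ')`);
Moonen–Zarhin 1999 Thm. 0.1 (a): the non-simple Weil-type fourfolds `E_k × X₂` carry the product
polarizations `a·L_E ⊠ b·L₂`.

## What is proved (0 sorry)

* `polarizationPairingOne_frame_row_ne_zero` — NON-DEGENERACY IN A FRAME: for `(A, φ)` of dimension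
  `m + 1 ≥ 2`, `φ ≫ φ = -d`, and the `K`-symmetrised hyperplane class `h_K`, the Gram matrix of `Q_{h_K}`
  in any SPANNING rational frame `u` has no zero row at a non-zero `uᵢ` (the rational Riemann form of
  `h_K` is non-degenerate, `nondegenerate_ratPolarizationForm_ksymm`);
* **`hasWeilDiscriminantNondeg_prod_of_kFrames`** — THE PRODUCT WITNESS: `K`-frames `x_A` (size `k_A`)
  and `x_B` (size `k_B`) of `(A, φ, h_A)`, `(B, ψ, h_B)` (`dim A = j_A + 1`, `dim B = j_B + 1`,
  `k_A + k_B = 2N`, `2N = dim A + dim B`) with Gram data `(a_A, b_A)`, `(a_B, b_B)`, top powers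
  `h_A^{dim A} = d_A ω_A`, `h_B^{dim B} = d_B ω_B` (`d_A, d_B ≠ 0`) and Gram determinants
  `det Ψ_A = q_A`, `det Ψ_B = q_B` in `ℚˣ` give, on `(A × B, φ × ψ, pr_A^* h_A + pr_B^* h_B)`, a
  non-degenerate discriminant witness of class
  `[(C(2N-1, j_A) d_B)^{k_A} · (C(2N-1, j_A+1) d_A)^{k_B} · q_A · q_B]` — "`det H` is multiplicative"
  on the carriers, with the binomial weights of `Motives/PolarizationPairingProduct`.

## References

* [vanGeemen1994HodgeAV] B. van Geemen, LNM 1594 (1994), Lemma 5.2 (2)–(3).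
* [Markman2025SurveySecant] E. Markman, arXiv:2509.23403, §11.5 Step 2.
* [Schoen1998HodgeWeilAddendum] C. Schoen, Compositio Math. 114 (1998), §10.
* [MoonenZarhin1999LowDim] B. Moonen, Yu. Zarhin, Math. Ann. 315 (1999), Thm. 0.1 (a).
-/

noncomputable section

open CategoryTheory Polynomial Module
open scoped Matrix
open Literature.AlgebraicTopology.SingularHomology
open Literature.AlgebraicGeometry.HodgeTheory
open Literature.AlgebraicGeometry.Motives
open Literature.Geometry.Kaehler

namespace Literature.AlgebraicGeometry.VanGeemen1994

/-! ### Non-degeneracy in a frame -/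

section RowNeZero

variable {m d : ℕ} {A : AbelianVariety ℂ}

/-- **The Gram matrix of `Q_{h_K}` in a spanning rational frame has no zero row** (at a non-zero frame
vector): the rational Riemann form of the `K`-symmetrised hyperplane class `h_K = d·e^*a + φ^*e^*a` is
NON-DEGENERATE (van Geemen Lemma 5.2 (2); the tree's `nondegenerate_ratPolarizationForm_ksymm`), and a
frame vector pairing to zero with a spanning family pairs to zero with everything.
[cite: vanGeemen1994HodgeAV, Lemma 5.2 (2)] -/
theorem polarizationPairingOne_frame_row_ne_zero (hm : 1 ≤ m) (hA : A.dim = m + 1) (hd : 0 < d)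
    (φ : A ⟶ A) (e : ProjectiveEmbedding A.X) {a : complexBetti (projectiveSpace e.n ℂ) 2}
    (ha : IsRationalClass a) (ha0 : a ≠ 0) {ι : Type*} [Fintype ι] (u : ι → complexBetti A.X 1)
    (hu : ∀ i, IsRationalClass (u i)) (hus : Submodule.span ℂ (Set.range u) = ⊤)
    (ω : complexBetti A.X (2 + 2 * m)) (G : Matrix ι ι ℚ)
    (hG : ∀ i j, polarizationPairingOne A.X
      ((d : ℂ) • complexBetti.map e.ι 2 a + complexBetti.map φ.hom.hom.hom 2 (complexBetti.map e.ι 2 a)) m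
      (u i) (u j) = ((G i j : ℚ) : ℂ) • ω)
    {i : ι} (hi : u i ≠ 0) : ∃ j, G i j ≠ 0 := by
  have hX : IsSmoothProjective (m + 1) A.X := Motives.isSmoothProjective_of_dim_eq' hA
  set hK := (d : ℂ) • complexBetti.map e.ι 2 a + complexBetti.map φ.hom.hom.hom 2 (complexBetti.map e.ι 2 a)
    with hKdef
  have h1 := Motives.finrank_complexBetti_two_add_two_mul_eq_one hX
  obtain ⟨ω₀, hω₀, hω₀0⟩ := Motives.exists_isRationalClass_ne_zero_two_add_two_mul hX
  have hN := nondegenerate_ratPolarizationForm_ksymm hm hA hd φ e ha ha0 hω₀ hω₀0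
  by_contra hall
  push Not at hall
  -- `Q(uᵢ, y) = 0` for every `y`
  have hzero : ∀ y : complexBetti A.X 1, polarizationPairingOne A.X hK m (u i) y = 0 := by
    intro y
    have hy : y ∈ Submodule.span ℂ (Set.range u) := by rw [hus]; exact Submodule.mem_top
    induction hy using Submodule.span_induction with
    | mem x hx =>
      obtain ⟨j, rfl⟩ := hx
      rw [hG, hall j, Rat.cast_zero, zero_smul]
    | zero => rw [map_zero]
    | add x y _ _ hx hy => rw [map_add, hx, hy, add_zero]
    | smul c x _ hx => rw [map_smul, hx, smul_zero]
  -- `uᵢ = v ⊗ 1` with `E(v, ·) = 0`, so `v = 0`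
  obtain ⟨v, hv⟩ := (isRationalClass_iff_mem_range_ofRatClass (u i)).1 (hu i)
  have hEv : ∀ w, ratPolarizationForm hK (isRationalClass_ksymm d φ e ha) m (lineCoord ω₀ hω₀0 h1)
      (lineCoord_ratValued _ hω₀ hω₀0) v w = 0 := fun w => by
    apply Rat.cast_injective (α := ℂ)
    rw [ratPolarizationForm_spec, hv, hzero, map_zero, Rat.cast_zero]
  have hv0 : v = 0 := hN.1 v hEv
  exact hi (by rw [← hv, hv0, map_zero])

end RowNeZero

/-! ### The product witness -/

section Product

variable {A B : AbelianVariety ℂ} {φ : A ⟶ A} {ψ : B ⟶ B}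

/-- **`det H` is multiplicative under products, on the carriers** — our formalisation of the one-sentence
printed claim of Markman, arXiv:2509.23403 §11.5 Step 2 (arXiv v2 PDF p. 21, lines 37–39; no proof, preprint, unrefereed); van Geemen
Lemma 5.2 (2)–(3) supplies only the `K`-frame / Gram matrix `Ψ` and `det Ψ ∈ ℚ^*/Nm(K^*)` (isogeny invariance),
not the multiplicativity; Schoen 1998 §10 for the lattice-sum context. Let `A`, `B` be complex abelian varieties of dimensions `j_A + 1`,
`j_B + 1` with endomorphisms `φ`, `ψ`, classes `h_A`, `h_B`, and `K`-FRAMES: rational classes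
`x_A : Fin k_A → H¹(A(ℂ))`, `x_B : Fin k_B → H¹(B(ℂ))` with `{x, φ^*x}` resp. `{x, ψ^*x}` `ℂ`-independent,
rational non-zero reference classes `ω_A`, `ω_B`, Gram data `Q_{h_A, j_A}(x_A i, φ^* x_A j) = a_A i j · ω_A`,
`Q_{h_A, j_A}(x_A i, x_A j) = b_A i j · ω_A` (same for `B`), top powers `h_A^{j_A+1} = d_A ω_A`,
`h_B^{j_B+1} = d_B ω_B` with `d_A, d_B ≠ 0`, and Gram determinants `det(a_A + b_A √-d) = q_A`,
`det(a_B + b_B √-d) = q_B` in `ℚˣ`. If `k_A + k_B = 2N` (an explicit re-indexing `ε`) and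
`2N = dim A + dim B`, then the product `(A × B, φ × ψ)` with the class `pr_A^* h_A + pr_B^* h_B` has a
NON-DEGENERATE DISCRIMINANT WITNESS (`HasWeilDiscriminantNondeg`) of class
`[(C(2N-1, j_A)·d_B)^{k_A} · (C(2N-1, j_A+1)·d_A)^{k_B} · q_A · q_B]`: the pulled-back frame is
rational and independent (Künneth in degree one), its Gram data is block diagonal with the binomial
weights of `Motives.polarizationPairingOne_add_map_map{,'}` (mixed blocks vanish), and the `K`-Gram
matrix is `diag(c_A Ψ_A, c_B Ψ_B)`. [cite: vanGeemen1994HodgeAV, Lemma 5.2 (2)–(3)]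
[cite: Markman2025SurveySecant, §11.5 Step 2] [cite: Schoen1998HodgeWeilAddendum, §10] -/
theorem hasWeilDiscriminantNondeg_prod_of_kFrames {jA jB N kA kB d : ℕ} (hAdim : A.dim = jA + 1)
    (hBdim : B.dim = jB + 1) (hN : 2 * N = jA + jB + 2) (ε : Fin kA ⊕ Fin kB ≃ Fin (2 * N))
    -- the frame of `A`
    (xA : Fin kA → complexBetti A.X 1) (hxA : ∀ i, IsRationalClass (xA i))
    (hiA : LinearIndependent ℂ (Sum.elim xA (fun i => complexBetti.map φ.hom.hom.hom 1 (xA i))))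
    (hA2 : complexBetti A.X 2) (ωA : complexBetti A.X (2 + 2 * jA)) (hωA : IsRationalClass ωA) (hωA0 : ωA ≠ 0)
    (aA bA : Matrix (Fin kA) (Fin kA) ℚ)
    (hpA : ∀ i j, polarizationPairingOne A.X hA2 jA (xA i) (complexBetti.map φ.hom.hom.hom 1 (xA j)) =
        ((aA i j : ℚ) : ℂ) • ωA ∧ polarizationPairingOne A.X hA2 jA (xA i) (xA j) = ((bA i j : ℚ) : ℂ) • ωA)
    (dA : ℚ) (hdA : lefschetzPow hA2 jA 2 hA2 = ((dA : ℚ) : ℂ) • ωA) (hdA0 : dA ≠ 0)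
    (qA : ℚˣ) (hqA : (weilGramMatrix d aA bA).det = algebraMap ℚ (weilField d) (qA : ℚ))
    -- the frame of `B`
    (xB : Fin kB → complexBetti B.X 1) (hxB : ∀ i, IsRationalClass (xB i))
    (hiB : LinearIndependent ℂ (Sum.elim xB (fun i => complexBetti.map ψ.hom.hom.hom 1 (xB i))))
    (hB2 : complexBetti B.X 2) (ωB : complexBetti B.X (2 + 2 * jB)) (hωB : IsRationalClass ωB) (hωB0 : ωB ≠ 0)
    (aB bB : Matrix (Fin kB) (Fin kB) ℚ)
    (hpB : ∀ i j, polarizationPairingOne B.X hB2 jB (xB i) (complexBetti.map ψ.hom.hom.hom 1 (xB j)) =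
        ((aB i j : ℚ) : ℂ) • ωB ∧ polarizationPairingOne B.X hB2 jB (xB i) (xB j) = ((bB i j : ℚ) : ℂ) • ωB)
    (dB : ℚ) (hdB : lefschetzPow hB2 jB 2 hB2 = ((dB : ℚ) : ℂ) • ωB) (hdB0 : dB ≠ 0)
    (qB : ℚˣ) (hqB : (weilGramMatrix d aB bB).det = algebraMap ℚ (weilField d) (qB : ℚ)) :
    HasWeilDiscriminantNondeg (A.prod B)
      (AbelianVariety.prodLift (AbelianVariety.fst A B ≫ φ) (AbelianVariety.snd A B ≫ ψ)) N d
      (complexBetti.map (AbelianVariety.fst A B).hom.hom.hom 2 hA2 +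
        complexBetti.map (AbelianVariety.snd A B).hom.hom.hom 2 hB2)
      (QuotientGroup.mk
        (Units.mk0 ((((2 * N - 1).choose jA : ℚ) * dB) ^ kA * ((((2 * N - 1).choose (jA + 1) : ℚ) * dA)) ^ kB)
            (mul_ne_zero (pow_ne_zero _ (mul_ne_zero (by
              have h := Nat.choose_pos (show jA ≤ 2 * N - 1 by omega)
              exact_mod_cast h.ne') hdB0))
              (pow_ne_zero _ (mul_ne_zero (by
              have h := Nat.choose_pos (show jA + 1 ≤ 2 * N - 1 by omega)
              exact_mod_cast h.ne') hdA0))) *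
          qA * qB)) := by
  classical
  have hX : Motives.IsSmoothProjective (jA + 1) A.X := isSmoothProjective_of_dim_eq' hAdim
  have hY : Motives.IsSmoothProjective (jB + 1) B.X := isSmoothProjective_of_dim_eq' hBdim
  have hm : 2 * N - 1 = jA + jB + 1 := by omega
  set f := (AbelianVariety.fst A B).hom.hom.hom with hf
  set g := (AbelianVariety.snd A B).hom.hom.hom with hg
  set Φ := AbelianVariety.prodLift (AbelianVariety.fst A B ≫ φ) (AbelianVariety.snd A B ≫ ψ) with hΦ
  set h : complexBetti (A.prod B).X 2 := complexBetti.map f 2 hA2 + complexBetti.map g 2 hB2 with hh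
  set cA : ℚ := ((2 * N - 1).choose jA : ℚ) * dB with hcA
  set cB : ℚ := ((2 * N - 1).choose (jA + 1) : ℚ) * dA with hcB
  -- the frame `X = (f^* x_A, g^* x_B)` on `Fin kA ⊕ Fin kB`, re-indexed by `ε`
  set X : Fin kA ⊕ Fin kB → complexBetti (A.prod B).X 1 :=
    Sum.elim (fun i => complexBetti.map f 1 (xA i)) (fun i => complexBetti.map g 1 (xB i)) with hXdef
  have hX_inl : ∀ i, X (Sum.inl i) = complexBetti.map f 1 (xA i) := fun i => rfl
  have hX_inr : ∀ i, X (Sum.inr i) = complexBetti.map g 1 (xB i) := fun i => rfl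
  have hΦX : ∀ s, complexBetti.map Φ.hom.hom.hom 1 (X s) =
      Sum.elim (fun i => complexBetti.map f 1 (complexBetti.map φ.hom.hom.hom 1 (xA i)))
        (fun i => complexBetti.map g 1 (complexBetti.map ψ.hom.hom.hom 1 (xB i))) s := by
    rintro (i | i)
    · exact map_prodLift_map_fst φ ψ 1 (xA i)
    · exact map_prodLift_map_snd φ ψ 1 (xB i)
  set ω : complexBetti (A.prod B).X (2 + 2 * (2 * N - 1)) :=
    cupProduct (by omega : (2 + 2 * jA) + (2 + 2 * jB) = 2 + 2 * (2 * N - 1))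
      (complexBetti.map f (2 + 2 * jA) ωA) (complexBetti.map g (2 + 2 * jB) ωB) with hω
  -- the Gram data in the frame `X`
  set a₀ : Matrix (Fin kA ⊕ Fin kB) (Fin kA ⊕ Fin kB) ℚ := Matrix.fromBlocks (cA • aA) 0 0 (cB • aB) with ha₀
  set b₀ : Matrix (Fin kA ⊕ Fin kB) (Fin kA ⊕ Fin kB) ℚ := Matrix.fromBlocks (cA • bA) 0 0 (cB • bB) with hb₀
  have hpairX : ∀ s t,
      polarizationPairingOne (A.prod B).X h (2 * N - 1) (X s) (complexBetti.map Φ.hom.hom.hom 1 (X t)) =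
          ((a₀ s t : ℚ) : ℂ) • ω ∧
        polarizationPairingOne (A.prod B).X h (2 * N - 1) (X s) (X t) = ((b₀ s t : ℚ) : ℂ) • ω := by
    intro s t
    rw [hΦX]
    rcases s with i | i <;> rcases t with j | j
    · refine ⟨?_, ?_⟩
      · rw [hX_inl, Sum.elim_inl, hh, polarizationPairingOne_add_map_map f g hX hY hA2 hB2 hm, (hpA i j).1, hdB,
          ha₀, Matrix.fromBlocks_apply₁₁, Matrix.smul_apply, smul_eq_mul]
        simp only [map_smul, LinearMap.smul_apply, smul_smul]
        rw [hω, hcA]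
        congr 1
        push_cast
        ring
      · rw [hX_inl, hX_inl, hh, polarizationPairingOne_add_map_map f g hX hY hA2 hB2 hm, (hpA i j).2, hdB,
          hb₀, Matrix.fromBlocks_apply₁₁, Matrix.smul_apply, smul_eq_mul]
        simp only [map_smul, LinearMap.smul_apply, smul_smul]
        rw [hω, hcA]
        congr 1
        push_cast
        ring
    · refine ⟨?_, ?_⟩
      · rw [hX_inl, Sum.elim_inr, hh, polarizationPairingOne_add_map_map_mixed f g hX hY hA2 hB2 hm, ha₀,
          Matrix.fromBlocks_apply₁₂, Matrix.zero_apply, Rat.cast_zero, zero_smul]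
      · rw [hX_inl, hX_inr, hh, polarizationPairingOne_add_map_map_mixed f g hX hY hA2 hB2 hm, hb₀,
          Matrix.fromBlocks_apply₁₂, Matrix.zero_apply, Rat.cast_zero, zero_smul]
    · refine ⟨?_, ?_⟩
      · rw [hX_inr, Sum.elim_inl, hh, polarizationPairingOne_add_map_map_mixed' f g hX hY hA2 hB2 hm, ha₀,
          Matrix.fromBlocks_apply₂₁, Matrix.zero_apply, Rat.cast_zero, zero_smul]
      · rw [hX_inr, hX_inl, hh, polarizationPairingOne_add_map_map_mixed' f g hX hY hA2 hB2 hm, hb₀,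
          Matrix.fromBlocks_apply₂₁, Matrix.zero_apply, Rat.cast_zero, zero_smul]
    · refine ⟨?_, ?_⟩
      · rw [hX_inr, Sum.elim_inr, hh, polarizationPairingOne_add_map_map' f g hX hY hA2 hB2 hm, (hpB i j).1, hdA,
          ha₀, Matrix.fromBlocks_apply₂₂, Matrix.smul_apply, smul_eq_mul]
        simp only [map_smul, LinearMap.smul_apply, smul_smul]
        rw [hω, hcB]
        congr 1
        push_cast
        ring
      · rw [hX_inr, hX_inr, hh, polarizationPairingOne_add_map_map' f g hX hY hA2 hB2 hm, (hpB i j).2, hdA,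
          hb₀, Matrix.fromBlocks_apply₂₂, Matrix.smul_apply, smul_eq_mul]
        simp only [map_smul, LinearMap.smul_apply, smul_smul]
        rw [hω, hcB]
        congr 1
        push_cast
        ring
  -- independence of `{X, Φ^* X}` (Künneth in degree one, re-indexed)
  have hind₀ : LinearIndependent ℂ (Sum.elim X (fun s => complexBetti.map Φ.hom.hom.hom 1 (X s))) := by
    have hK := linearIndependent_sumElim_map_fst_map_snd (A := A) (B := B) hiA hiB
    let σ : (Fin kA ⊕ Fin kB) ⊕ (Fin kA ⊕ Fin kB) ≃ (Fin kA ⊕ Fin kA) ⊕ (Fin kB ⊕ Fin kB) :=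
      Equiv.sumSumSumComm (Fin kA) (Fin kB) (Fin kA) (Fin kB)
    have heq : Sum.elim X (fun s => complexBetti.map Φ.hom.hom.hom 1 (X s)) =
        (Sum.elim (fun i => complexBetti.map (AbelianVariety.fst A B).hom.hom.hom 1
            (Sum.elim xA (fun i => complexBetti.map φ.hom.hom.hom 1 (xA i)) i))
          (fun k => complexBetti.map (AbelianVariety.snd A B).hom.hom.hom 1
            (Sum.elim xB (fun i => complexBetti.map ψ.hom.hom.hom 1 (xB i)) k))) ∘ σ := by
      funext s
      rcases s with (i | i) | (i | i)
      · rfl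
      · rfl
      · simp only [Sum.elim_inr, Function.comp_apply, hΦX, Sum.elim_inl]
        rfl
      · simp only [Sum.elim_inr, Function.comp_apply, hΦX]
        rfl
    rw [heq]
    exact hK.comp σ σ.injective
  -- the witness
  refine ⟨fun k => X (ε.symm k), ω, Matrix.reindex ε ε a₀, Matrix.reindex ε ε b₀,
    Units.mk0 (cA ^ kA * cB ^ kB) (mul_ne_zero (pow_ne_zero _ (mul_ne_zero (by
        have h := Nat.choose_pos (show jA ≤ 2 * N - 1 by omega)
        exact_mod_cast h.ne') hdB0)) (pow_ne_zero _ (mul_ne_zero (by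
        have h := Nat.choose_pos (show jA + 1 ≤ 2 * N - 1 by omega)
        exact_mod_cast h.ne') hdA0))) * qA * qB,
    fun k => ?_, ?_, ?_, ?_, fun k l => ?_, ?_, rfl⟩
  · -- rationality
    have hXrat : ∀ s, IsRationalClass (X s) := by
      rintro (i | i)
      · exact (hxA i).map _
      · exact (hxB i).map _
    exact hXrat _
  · -- independence
    have heq : Sum.elim (fun k => X (ε.symm k)) (fun k => complexBetti.map Φ.hom.hom.hom 1 (X (ε.symm k))) =
        Sum.elim X (fun s => complexBetti.map Φ.hom.hom.hom 1 (X s)) ∘ Equiv.sumCongr ε.symm ε.symm := by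
      funext s
      rcases s with k | k <;> rfl
    rw [heq]
    exact hind₀.comp _ (Equiv.sumCongr ε.symm ε.symm).injective
  · -- `ω` rational
    exact ((hωA.map _).cup _ (hωB.map _))
  · -- `ω ≠ 0` (Künneth)
    exact cupProduct_map_fst_map_snd_ne_zero_of_add_eq hX hY _ (by omega) hωA0 hωB0
  · exact hpairX (ε.symm k) (ε.symm l)
  · -- the determinant
    have hblock : weilGramMatrix d (Matrix.reindex ε ε a₀) (Matrix.reindex ε ε b₀) =
        Matrix.reindex ε ε (Matrix.fromBlocks (algebraMap ℚ (weilField d) cA • weilGramMatrix d aA bA) 0 0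
          (algebraMap ℚ (weilField d) cB • weilGramMatrix d aB bB)) := by
      ext k l
      rw [weilGramMatrix_apply, Matrix.reindex_apply, Matrix.reindex_apply, Matrix.reindex_apply,
        Matrix.submatrix_apply, Matrix.submatrix_apply, Matrix.submatrix_apply]
      rcases ε.symm k with i | i <;> rcases ε.symm l with j | j
      · simp only [ha₀, hb₀, Matrix.fromBlocks_apply₁₁, Matrix.smul_apply, smul_eq_mul, weilGramMatrix_apply,
          map_mul]
        ring
      · simp [ha₀, hb₀]
      · simp [ha₀, hb₀]
      · simp only [ha₀, hb₀, Matrix.fromBlocks_apply₂₂, Matrix.smul_apply, smul_eq_mul, weilGramMatrix_apply,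
          map_mul]
        ring
    rw [hblock, Matrix.det_reindex_self, Matrix.det_fromBlocks_zero₁₂, Matrix.det_smul, Matrix.det_smul, hqA, hqB,
      Fintype.card_fin, Fintype.card_fin, Units.val_mul, Units.val_mul, Units.val_mk0]
    simp only [map_mul, map_pow]
    ring

end Product

end Literature.AlgebraicGeometry.VanGeemen1994

end
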